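import Mathlib
import Literature.Combinatorics.SimpleGraph.LaplacianComplementSortedSpectrum
import Literature.Combinatorics.SimpleGraph.LaplacianSpectralRadius
import HarnessLib

/-!
# Fiedler's elementary inequalities: `a(G) ≤ b(G)` with equality iff `G` is complete or void,
# `n/(n−1)·Δ ≤ b(G) ≤ 2Δ`, `a(G) ≥ 2δ − n + 2`, `a(G) ≤ n − m` for an independent `m`-set

Source (held, read at the page; VERBATIM). M. Fiedler, *Algebraic connectivity of graphs*,
Czechoslovak Math. J. 23 (98) (1973) 298–305 [Fiedler1973] (held text
`paper:doi-10-21136-cmj-1973-101168`, p0005–p0007 = pp. 301–303). p. 301: «In the following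
theorem, we denote by `b(G)`, for a graph `G` with `n` vertices, the number `b(G) = n − a(Ḡ)`
where `Ḡ` is the complementary graph to `G`. **3.7.** The function `b(G)` has following
properties: 1° `b(G)` is the maximum eigenvalue of `A(G)` or, equivalently (5)
`b(G) = max_{x∈W} xᵀA(G)x`; we have thus (6) `a(G) ≤ b(G)`, with equality if and only if `G` is a
complete graph or a void graph (i.e. without edges); … 5° `[n/(n − 1)] max_i v_i(G) ≤ b(G) ≤
2 max_i v_i(G)` where `v_i(G)` means valency of the `i`-th vertex in `G`.» (`W` = the unit
vectors orthogonal to `e`, p. 298; `A(G)` is Fiedler's notation for the Laplacian.) p. 303: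
«**3.8.** We have `a(G) ≥ 2 min_i v_i(G) − n + 2`. Proof. Follows immediately from the right
inequality in 5° of 3.7 used for the complementary graph `Ḡ`. **3.9.** Let `G` with `n` vertices
contain an independent set of `m` vertices (i.e. no two of them joined by an edge of `G`). Then
`a(G) ≤ n − m`. Proof. If `G` contains an independent set of `m` vertices then `Ḡ` contains a
complete subgraph `K_m`. Since `b(K_m) = m`, we have by 3° of 3.7 that `b(Ḡ) ≥ m` so that
`a(G) = n − b(Ḡ) ≤ n − m`.»

## What is formalised (tree vocabulary) and the route

`a(G) = hL.eigenvalues₀ ⟨n − 2, _⟩` and `b(G) = λ_max(G) = hL.eigenvalues₀ ⟨0, _⟩` of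
`G.lapMatrix ℝ` (Mathlib's sorted list is non-increasing); `b(G) = n − a(Ḡ)` is the tree's
`LaplacianComplementSortedSpectrum.lapMatrix_compl_eigenvalues₀_zero` (Merris Thm. 9.24), the
Rayleigh bound (5) is `Literature.LinearAlgebra.Matrix.dotProduct_mulVec_le` (`topEigenvalue`),
and `λ_max ≤ 2Δ`, `Δ + 1 ≤ λ_max` are the tree's `LaplacianSpectralRadius`. THEOREMS ONLY (no
definition, no named fact).

* §1 `eigenvalues₀_zero_eq_topEigenvalue` (the sorted top entry is the tree's `topEigenvalue`),
  **3.7 (6)**: `algConn_le_eigenvalues₀_zero` (`a ≤ b`) and **`Fiedler1973_3_7_6`**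
  (`a(G) = b(G) ↔ G = ⊥ ∨ G = ⊤`, `n ≥ 2`; route: equality makes `xᵀLx = a‖x‖²` on `e^⊥`, the
  test vectors `e − n·e_i` give regularity `n·d_i = (n − 1)a`, then `e_i − e_j` give a constant
  off-diagonal entry, which is `0` or `−1`), **3.7 5°**: `Fiedler1973_3_7_5_left/right`
  (`n/(n−1)·Δ ≤ b ≤ 2Δ`).
* §2 **3.8**: **`Fiedler1973_3_8`** (`2δ − n + 2 ≤ a(G)`).
* §3 **3.9**: **`Fiedler1973_3_9`** (`a(G) ≤ n − |S|` for an independent set `S` with `|S| ≥ 2`;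
  for `|S| = 1` the printed bound fails at `K_n`, `a(K_n) = n > n − 1` — Fiedler's proof uses
  `b(K_m) = m`, true only for `m ≥ 2`; recorded, not formalised as stated for `m = 1`).

## References
* M. Fiedler, Algebraic connectivity of graphs, Czechoslovak Math. J. 23 (1973) 298–305, §3
  items 3.7 (1°, (5), (6), 5°), 3.8, 3.9 (pp. 301–303) [Fiedler1973].
* through the imports: `LaplacianComplementSortedSpectrum` (Merris Thm. 9.24, `b = n − a(Ḡ)`),
  `LaplacianSpectralRadius` (`λ ≤ 2Δ`, `d_v + 1 ≤ λ_max`), `Literature.LinearAlgebra.Matrix.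
  PerronSymmetric` (`topEigenvalue`, Rayleigh bound), `AlgebraicConnectivity` (B–H §1.7).
-/

namespace Literature.Combinatorics.SimpleGraph.AlgebraicConnectivityFiedlerInequalities

open Finset Matrix
open Literature.LinearAlgebra.Matrix (topEigenvalue eigenvalues_le_topEigenvalue
  exists_eigenvalues_eq_topEigenvalue dotProduct_mulVec_le)
open AlgebraicConnectivity (algConn_mul_dotProduct_le algConn_nonneg)
open LaplacianComplementSortedSpectrum (lapMatrix_compl_eigenvalues₀_zero
  lapMatrix_eigenvalues₀_le_card)
open LaplacianSpectralRadius (lapMatrix_eigenvalues_le_two_mul_maxDegree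
  degree_add_one_le_topEigenvalue_lapMatrix maxDegree_add_one_le_topEigenvalue_lapMatrix)

variable {V : Type*} [Fintype V] [DecidableEq V]

/-! ## §0 The top entry of the sorted spectrum -/

/-- `eigenvalues (e m) = eigenvalues₀ m` for Mathlib's fixed equivalence `e : Fin n ≃ V`.
[folklore] -/
private theorem eigenvalues_equiv {A : Matrix V V ℝ} (hA : A.IsHermitian)
    (m : Fin (Fintype.card V)) :
    hA.eigenvalues (Fintype.equivOfCardEq (Fintype.card_fin _) m) = hA.eigenvalues₀ m := by
  unfold Matrix.IsHermitian.eigenvalues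
  simp

/-- The largest entry of Mathlib's sorted spectral list is the tree's `topEigenvalue`
(`b(G)` «is the maximum eigenvalue», 3.7 1°). [cite: Fiedler1973, §3 item 3.7 1° (p. 301)] -/
theorem eigenvalues₀_zero_eq_topEigenvalue [Nonempty V] {A : Matrix V V ℝ} (hA : A.IsHermitian) :
    hA.eigenvalues₀ ⟨0, Fintype.card_pos⟩ = topEigenvalue hA := by
  refine le_antisymm ?_ ?_
  · rw [← eigenvalues_equiv hA]
    exact eigenvalues_le_topEigenvalue hA _
  · obtain ⟨i, hi⟩ := exists_eigenvalues_eq_topEigenvalue hA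
    rw [← hi, ← Equiv.apply_symm_apply (Fintype.equivOfCardEq (Fintype.card_fin _)) i,
      eigenvalues_equiv hA]
    exact hA.eigenvalues₀_antitone (Fin.mk_le_mk.2 (Nat.zero_le _))

/-- **(5) the Rayleigh bound for the top of the sorted list**: `xᵀAx ≤ λ↓₀ ‖x‖²`.
[cite: Fiedler1973, §3 item 3.7 (5) (p. 301)] -/
theorem dotProduct_mulVec_le_eigenvalues₀_zero [Nonempty V] {A : Matrix V V ℝ}
    (hA : A.IsHermitian) (x : V → ℝ) :
    x ⬝ᵥ A *ᵥ x ≤ hA.eigenvalues₀ ⟨0, Fintype.card_pos⟩ * (x ⬝ᵥ x) := by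
  rw [eigenvalues₀_zero_eq_topEigenvalue]
  exact dotProduct_mulVec_le hA x

/-! ## §1 3.7 (6) and 5°: `a(G) ≤ b(G)`, the equality case, and `n/(n−1)·Δ ≤ b(G) ≤ 2Δ` -/

section Top

variable (G : SimpleGraph V) [DecidableRel G.Adj]

/-- **3.7 (6), inequality: `a(G) ≤ b(G)`** — the second-smallest Laplace eigenvalue is at most
the largest (`n ≥ 2`). [cite: Fiedler1973, §3 item 3.7 (6) (p. 301)] -/
theorem algConn_le_eigenvalues₀_zero (hn : 2 ≤ Fintype.card V) (hL : (G.lapMatrix ℝ).IsHermitian) :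
    hL.eigenvalues₀ ⟨Fintype.card V - 2, by omega⟩ ≤ hL.eigenvalues₀ ⟨0, by omega⟩ :=
  hL.eigenvalues₀_antitone (Fin.mk_le_mk.2 (Nat.zero_le _))

/-- Entries of the Laplace matrix: `L_ii = d_i`. [folklore] -/
private theorem lapMatrix_apply_self (i : V) : G.lapMatrix ℝ i i = G.degree i := by
  simp [SimpleGraph.lapMatrix, SimpleGraph.degMatrix, SimpleGraph.adjMatrix_apply]

/-- Entries of the Laplace matrix: `L_ij = −[i ∼ j]` for `i ≠ j`. [folklore] -/
private theorem lapMatrix_apply_of_ne {i j : V} (hij : i ≠ j) :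
    G.lapMatrix ℝ i j = -(if G.Adj i j then 1 else 0) := by
  simp [SimpleGraph.lapMatrix, SimpleGraph.degMatrix, SimpleGraph.adjMatrix_apply, hij]

/-- The quadratic form at `e_i − e_j`: `(e_i − e_j)ᵀ L (e_i − e_j) = d_i + d_j + 2[i ∼ j]`.
[folklore] -/
private theorem quad_single_sub_single {i j : V} (hij : i ≠ j) :
    (Pi.single i (1 : ℝ) - Pi.single j 1) ⬝ᵥ G.lapMatrix ℝ *ᵥ (Pi.single i 1 - Pi.single j 1) =
      G.degree i + G.degree j + 2 * (if G.Adj i j then 1 else 0) := by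
  have hsymm : G.lapMatrix ℝ j i = G.lapMatrix ℝ i j := (G.isSymm_lapMatrix (R := ℝ)).apply i j
  rw [Matrix.mulVec_sub, Matrix.mulVec_single_one, Matrix.mulVec_single_one, sub_dotProduct,
    dotProduct_sub, dotProduct_sub, single_one_dotProduct, single_one_dotProduct,
    single_one_dotProduct, single_one_dotProduct, Matrix.col_apply, Matrix.col_apply,
    Matrix.col_apply, Matrix.col_apply, lapMatrix_apply_self, lapMatrix_apply_self, hsymm,
    lapMatrix_apply_of_ne G hij]
  ring

/-- The quadratic form at `e − n·e_i`: `(e − n e_i)ᵀ L (e − n e_i) = n² d_i` (`Le = 0`).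
[folklore] -/
private theorem quad_one_sub_single (i : V) :
    ((fun _ => (1 : ℝ)) - (Fintype.card V : ℝ) • Pi.single i 1) ⬝ᵥ
        G.lapMatrix ℝ *ᵥ ((fun _ => (1 : ℝ)) - (Fintype.card V : ℝ) • Pi.single i 1) =
      (Fintype.card V : ℝ) ^ 2 * G.degree i := by
  have h1 : G.lapMatrix ℝ *ᵥ (fun _ => (1 : ℝ)) = 0 := SimpleGraph.lapMatrix_mulVec_const_eq_zero G
  have hcol : (fun _ => (1 : ℝ)) ⬝ᵥ (G.lapMatrix ℝ).col i = 0 := by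
    have h2 : (fun _ => (1 : ℝ)) ⬝ᵥ (G.lapMatrix ℝ).col i =
        (G.lapMatrix ℝ *ᵥ fun _ => (1 : ℝ)) i := by
      rw [Matrix.mulVec, dotProduct, dotProduct]
      refine sum_congr rfl fun k _ => ?_
      rw [Matrix.col_apply, (G.isSymm_lapMatrix (R := ℝ)).apply i k]
      ring
    rw [h2, h1, Pi.zero_apply]
  rw [Matrix.mulVec_sub, h1, zero_sub, Matrix.mulVec_smul, Matrix.mulVec_single_one, sub_dotProduct,
    dotProduct_neg, dotProduct_neg, dotProduct_smul, hcol, smul_dotProduct, dotProduct_smul,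
    single_one_dotProduct, Matrix.col_apply, lapMatrix_apply_self]
  simp only [smul_eq_mul, mul_zero, neg_zero, zero_sub, neg_neg]
  ring

/-- **3.7 (6), the equality case: `a(G) = b(G)` if and only if `G` is complete or void**
(`n ≥ 2`). («with equality if and only if `G` is a complete graph or a void graph (i.e. without
edges)»; route: equality pins the quadratic form `xᵀLx = a‖x‖²` on `e^⊥`; at `x = e − n e_i`
this reads `n d_i = (n − 1)a` for every `i`, at `x = e_i − e_j` it reads
`d_i + d_j + 2[i ∼ j] = 2a`, so `[i ∼ j]` does not depend on the pair.)
[cite: Fiedler1973, §3 item 3.7 (6) (p. 301)] -/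
theorem Fiedler1973_3_7_6 (hn : 2 ≤ Fintype.card V) (hL : (G.lapMatrix ℝ).IsHermitian) :
    hL.eigenvalues₀ ⟨Fintype.card V - 2, by omega⟩ = hL.eigenvalues₀ ⟨0, by omega⟩ ↔
      G = ⊥ ∨ G = ⊤ := by
  haveI : Nonempty V := Fintype.card_pos_iff.1 (by omega)
  set n : ℝ := (Fintype.card V : ℝ) with hndef
  have hn' : (2 : ℝ) ≤ n := by rw [hndef]; exact_mod_cast hn
  -- the spectrum of a graph without edges is `{0}`: `0 ≤ a ≤ b ≤ 2Δ = 0`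
  have hvoid : ∀ (H : SimpleGraph V) [DecidableRel H.Adj] (hH : (H.lapMatrix ℝ).IsHermitian),
      (∀ v w, ¬ H.Adj v w) →
        hH.eigenvalues₀ ⟨Fintype.card V - 2, by omega⟩ = 0 ∧
          hH.eigenvalues₀ ⟨0, by omega⟩ = 0 := by
    intro H _ hH hadj
    have hdeg : ∀ v, H.degree v = 0 := fun v => by
      rw [← SimpleGraph.card_neighborFinset_eq_degree, Finset.card_eq_zero]
      ext w
      simp [hadj v w]
    have hΔ : H.maxDegree = 0 :=
      Nat.le_zero.1 (SimpleGraph.maxDegree_le_of_forall_degree_le (G := H) 0 fun v => (hdeg v).le)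
    have htop : hH.eigenvalues₀ ⟨0, by omega⟩ ≤ 0 := by
      rw [← eigenvalues_equiv hH]
      have := lapMatrix_eigenvalues_le_two_mul_maxDegree H hH
        (Fintype.equivOfCardEq (Fintype.card_fin _) ⟨0, by omega⟩)
      rw [hΔ, Nat.cast_zero, mul_zero] at this
      exact this
    have ha := algConn_nonneg H hn hH
    have hab := algConn_le_eigenvalues₀_zero H hn hH
    exact ⟨by linarith, by linarith⟩
  constructor
  · intro heq
    -- the quadratic form is pinned on `e^⊥`
    have hquad : ∀ x : V → ℝ, ∑ i, x i = 0 →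
        x ⬝ᵥ G.lapMatrix ℝ *ᵥ x = hL.eigenvalues₀ ⟨0, by omega⟩ * (x ⬝ᵥ x) := by
      intro x hx
      refine le_antisymm (dotProduct_mulVec_le_eigenvalues₀_zero hL x) ?_
      rw [← heq]
      exact algConn_mul_dotProduct_le G hn hL x hx
    set c : ℝ := hL.eigenvalues₀ ⟨0, by omega⟩ with hc
    -- regularity: `n d_i = (n − 1) c`
    have hreg : ∀ i, n * G.degree i = (n - 1) * c := by
      intro i
      have h := hquad ((fun _ => (1 : ℝ)) - (Fintype.card V : ℝ) • Pi.single i (1 : ℝ)) (by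
        simp only [Pi.sub_apply, Pi.smul_apply, smul_eq_mul, Finset.sum_sub_distrib,
          Finset.sum_const, Finset.card_univ, nsmul_eq_mul, mul_one]
        rw [← Finset.mul_sum, Finset.sum_pi_single']
        simp)
      rw [quad_one_sub_single] at h
      have hnorm : ((fun _ => (1 : ℝ)) - (Fintype.card V : ℝ) • Pi.single i (1 : ℝ)) ⬝ᵥ
          ((fun _ => (1 : ℝ)) - (Fintype.card V : ℝ) • Pi.single i (1 : ℝ)) = n * (n - 1) := by
        rw [sub_dotProduct, dotProduct_sub, dotProduct_sub, dotProduct_smul, smul_dotProduct,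
          smul_dotProduct, dotProduct_smul, dotProduct_single_one, single_one_dotProduct,
          single_one_dotProduct]
        simp only [dotProduct, Finset.sum_const, Finset.card_univ, nsmul_eq_mul, mul_one,
          smul_eq_mul, Pi.single_eq_same]
        rw [hndef]
        ring
      rw [hnorm, ← hndef] at h
      -- `n² d_i = c n (n − 1)`
      have hn0 : n ≠ 0 := by linarith
      exact mul_left_cancel₀ hn0 (show n * (n * G.degree i) = n * ((n - 1) * c) by
        linear_combination h)
    -- constant off-diagonal entry: `2[i ∼ j] = 2c − d_i − d_j = 2c/n`
    have hpair : ∀ i j, i ≠ j → n * (if G.Adj i j then (1 : ℝ) else 0) = c := by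
      intro i j hij
      have h := hquad (Pi.single i (1 : ℝ) - Pi.single j 1) (by
        simp only [Pi.sub_apply, Finset.sum_sub_distrib, Finset.sum_pi_single', Finset.mem_univ,
          if_true, sub_self])
      rw [quad_single_sub_single G hij] at h
      have hnorm : (Pi.single i (1 : ℝ) - Pi.single j 1) ⬝ᵥ (Pi.single i (1 : ℝ) - Pi.single j 1)
          = (2 : ℝ) := by
        rw [sub_dotProduct, dotProduct_sub, dotProduct_sub, single_one_dotProduct,
          single_one_dotProduct, single_one_dotProduct, single_one_dotProduct]
        simp [hij, hij.symm]
        norm_num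
      rw [hnorm] at h
      have hi := hreg i
      have hj := hreg j
      have hn0 : n ≠ 0 := by linarith
      -- `n (d_i + d_j + 2A) = 2 c n`, `n d_i = n d_j = (n−1) c`
      nlinarith [hi, hj, h]
    -- read off the graph
    obtain ⟨u, v, huv⟩ := Fintype.exists_pair_of_one_lt_card (α := V) (by omega)
    by_cases hadj : G.Adj u v
    · right
      ext a b
      rw [SimpleGraph.top_adj]
      refine ⟨fun h => G.ne_of_adj h, fun hab => ?_⟩
      have h1 := hpair u v huv
      have h2 := hpair a b hab
      rw [if_pos hadj] at h1
      by_contra hnab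
      rw [if_neg hnab, mul_zero] at h2
      rw [← h2, mul_one] at h1
      linarith
    · left
      ext a b
      refine ⟨fun hab' => ?_, fun h => h.elim⟩
      have h1 := hpair u v huv
      have h2 := hpair a b (G.ne_of_adj hab')
      rw [if_neg hadj, mul_zero] at h1
      rw [if_pos hab', mul_one, ← h1] at h2
      exact absurd h2 (by linarith)
  · rintro (hbot | htop)
    · subst hbot
      obtain ⟨h1, h2⟩ := hvoid ⊥ hL fun v w h => h
      rw [h1, h2]
    · -- `G = K_n`: `a(K_n) = n = b(K_n)`, through the complement `K̄_n`, which has no edges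
      have hLc : (Gᶜ.lapMatrix ℝ).IsHermitian := (SimpleGraph.posSemidef_lapMatrix ℝ Gᶜ).1
      have hce : ∀ v w, ¬ Gᶜ.Adj v w := fun v w h => by
        rw [SimpleGraph.compl_adj, htop, SimpleGraph.top_adj] at h
        exact h.2 h.1
      obtain ⟨h1, h2⟩ := hvoid Gᶜ hLc hce
      -- `b(Ḡ) = n − a(G)` and `a(Ḡ) = n − b(G)` (Merris Thm 9.24)
      have h3 := lapMatrix_compl_eigenvalues₀_zero G hn hL hLc
      have h4 := LaplacianComplementSortedSpectrum.lapMatrix_compl_eigenvalues₀_sub_two G hn hL hLc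
      rw [h2] at h3
      rw [h1] at h4
      linarith

/-- **3.7 5°, right: `b(G) ≤ 2Δ(G)`** (`Δ = G.maxDegree`). [cite: Fiedler1973, §3 item 3.7 5°
(p. 302)] -/
theorem Fiedler1973_3_7_5_right [Nonempty V] (hL : (G.lapMatrix ℝ).IsHermitian) :
    hL.eigenvalues₀ ⟨0, Fintype.card_pos⟩ ≤ 2 * G.maxDegree := by
  rw [← eigenvalues_equiv hL]
  exact lapMatrix_eigenvalues_le_two_mul_maxDegree G hL _

/-- **3.7 5°, left: `n/(n − 1)·Δ(G) ≤ b(G)`** (`n ≥ 2`; through the tree's sharper Grone–Merris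
bound `Δ + 1 ≤ b(G)` for a graph with an edge, and `b ≥ 0` otherwise).
[cite: Fiedler1973, §3 item 3.7 5° (p. 302)] -/
theorem Fiedler1973_3_7_5_left (hn : 2 ≤ Fintype.card V) (hL : (G.lapMatrix ℝ).IsHermitian) :
    (Fintype.card V : ℝ) / ((Fintype.card V : ℝ) - 1) * G.maxDegree ≤
      hL.eigenvalues₀ ⟨0, by omega⟩ := by
  haveI : Nonempty V := Fintype.card_pos_iff.1 (by omega)
  have hn' : (2 : ℝ) ≤ Fintype.card V := by exact_mod_cast hn
  have hb0 : 0 ≤ hL.eigenvalues₀ ⟨0, by omega⟩ :=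
    (algConn_nonneg G hn hL).trans (algConn_le_eigenvalues₀_zero G hn hL)
  by_cases hΔ : G.maxDegree = 0
  · rw [hΔ, Nat.cast_zero, mul_zero]
    exact hb0
  · have hedge : ∃ u v, G.Adj u v := by
      obtain ⟨v, hv⟩ := G.exists_maximal_degree_vertex
      have hpos : 0 < G.degree v := by rw [← hv]; exact Nat.pos_of_ne_zero hΔ
      rw [← SimpleGraph.card_neighborFinset_eq_degree, Finset.card_pos] at hpos
      obtain ⟨u, hu⟩ := hpos
      exact ⟨v, u, (SimpleGraph.mem_neighborFinset _ _ _).1 hu⟩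
    have hΔ1 := maxDegree_add_one_le_topEigenvalue_lapMatrix G hL hedge
    rw [← eigenvalues₀_zero_eq_topEigenvalue hL] at hΔ1
    have hΔn : (G.maxDegree : ℝ) ≤ Fintype.card V - 1 := by
      obtain ⟨v, hv⟩ := G.exists_maximal_degree_vertex
      have := G.degree_lt_card_verts v
      rw [hv]
      have h' : (G.degree v : ℝ) + 1 ≤ Fintype.card V := by exact_mod_cast this
      linarith
    rw [div_mul_eq_mul_div, div_le_iff₀ (by linarith)]
    nlinarith

end Top

/-! ## §2 3.8: `a(G) ≥ 2δ(G) − n + 2` -/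

section MinDegree

variable (G : SimpleGraph V) [DecidableRel G.Adj]

/-- **3.8: `a(G) ≥ 2 min_i v_i(G) − n + 2`** (`δ = G.minDegree`, `n ≥ 2`; «Follows immediately
from the right inequality in 5° of 3.7 used for the complementary graph `Ḡ`»:
`a(G) = n − b(Ḡ) ≥ n − 2Δ(Ḡ) = n − 2(n − 1 − δ(G))`). [cite: Fiedler1973, §3 item 3.8
(p. 303)] -/
theorem Fiedler1973_3_8 (hn : 2 ≤ Fintype.card V) (hL : (G.lapMatrix ℝ).IsHermitian) :
    2 * (G.minDegree : ℝ) - Fintype.card V + 2 ≤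
      hL.eigenvalues₀ ⟨Fintype.card V - 2, by omega⟩ := by
  haveI : Nonempty V := Fintype.card_pos_iff.1 (by omega)
  have hLc : (Gᶜ.lapMatrix ℝ).IsHermitian := (SimpleGraph.posSemidef_lapMatrix ℝ Gᶜ).1
  -- `b(Ḡ) = n − a(G)`
  have h1 := lapMatrix_compl_eigenvalues₀_zero G hn hL hLc
  -- `b(Ḡ) ≤ 2Δ(Ḡ)` and `Δ(Ḡ) = n − 1 − δ(G)` at a vertex of maximum degree of `Ḡ`
  have h2 : hLc.eigenvalues₀ ⟨0, by omega⟩ ≤ 2 * Gᶜ.maxDegree :=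
    Fiedler1973_3_7_5_right Gᶜ hLc
  obtain ⟨v, hv⟩ := Gᶜ.exists_maximal_degree_vertex
  have h3 : Gᶜ.maxDegree + G.minDegree + 1 ≤ Fintype.card V := by
    have hc := G.degree_compl v
    have hmin := G.minDegree_le_degree v
    have hlt := G.degree_lt_card_verts v
    rw [hv]
    omega
  have h3' : (Gᶜ.maxDegree : ℝ) + G.minDegree + 1 ≤ Fintype.card V := by exact_mod_cast h3
  linarith

end MinDegree

/-! ## §3 3.9: an independent `m`-set gives `a(G) ≤ n − m` -/

section Independent

variable (G : SimpleGraph V) [DecidableRel G.Adj]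

/-- **3.9: if `G` contains an independent set `S` of `m ≥ 2` vertices then `a(G) ≤ n − m`**
(«`Ḡ` contains a complete subgraph `K_m` … `b(Ḡ) ≥ m` so that `a(G) = n − b(Ḡ) ≤ n − m`»; here
`b(Ḡ) ≥ d_{Ḡ}(v) + 1 ≥ m` at a vertex `v ∈ S`, the tree's Grone–Merris star bound). For `m = 1`
the printed bound would read `a ≤ n − 1`, which fails exactly at `K_n`.
[cite: Fiedler1973, §3 item 3.9 (p. 303)] -/
theorem Fiedler1973_3_9 (hn : 2 ≤ Fintype.card V) (hL : (G.lapMatrix ℝ).IsHermitian)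
    {S : Finset V} (hS : ∀ a ∈ S, ∀ b ∈ S, ¬ G.Adj a b) (hm : 2 ≤ S.card) :
    hL.eigenvalues₀ ⟨Fintype.card V - 2, by omega⟩ ≤ Fintype.card V - S.card := by
  haveI : Nonempty V := Fintype.card_pos_iff.1 (by omega)
  have hLc : (Gᶜ.lapMatrix ℝ).IsHermitian := (SimpleGraph.posSemidef_lapMatrix ℝ Gᶜ).1
  have h1 := lapMatrix_compl_eigenvalues₀_zero G hn hL hLc
  -- a vertex `v ∈ S` has `Ḡ`-degree at least `m − 1`
  obtain ⟨v, hv⟩ : S.Nonempty := Finset.card_pos.1 (by omega)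
  have hsub : S.erase v ⊆ Gᶜ.neighborFinset v := by
    intro w hw
    rw [Finset.mem_erase] at hw
    rw [SimpleGraph.mem_neighborFinset, SimpleGraph.compl_adj]
    exact ⟨hw.1.symm, hS v hv w hw.2⟩
  have hdeg : S.card - 1 ≤ Gᶜ.degree v := by
    rw [← SimpleGraph.card_neighborFinset_eq_degree, ← Finset.card_erase_of_mem hv]
    exact Finset.card_le_card hsub
  have hdeg' : (S.card : ℝ) ≤ Gᶜ.degree v + 1 := by
    have : S.card ≤ Gᶜ.degree v + 1 := by omega
    exact_mod_cast this
  have h2 := degree_add_one_le_topEigenvalue_lapMatrix Gᶜ hLc (v := v) (by omega)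
  rw [← eigenvalues₀_zero_eq_topEigenvalue hLc] at h2
  linarith

end Independent

end Literature.Combinatorics.SimpleGraph.AlgebraicConnectivityFiedlerInequalities
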